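import Literature.Analysis.FluidPDE.FiniteFourierModeEulerFacetsA
import Literature.Analysis.FluidPDE.FiniteFourierModeEulerGirard

/-!
# A face of small solid angle at the vertex of maximal length

Support file for `FiniteFourierModeEuler` (N. Kishimoto, T. Yoneda, J. Math. Fluid Mech. 24
(2022) 74 = arXiv:2110.08039). In the proofs of Prop. 4.4 (iv) and Prop. 4.7: "`Ŝ^{conv}` is a
symmetric polyhedron … it has at least six faces, and hence there exists a face `F̂` of `Ŝ^{conv}`
such that the area `A(F̂*)` of the corresponding spherical polygon is not greater than `2π/3`."
We prove the volume version at the vertex `p₀` of maximal length: the three facet functionals of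
`exists_three_facets` and their negatives define six cones with pairwise null intersections and
the symmetry `x ↦ -x`, so one of the three cones at `p₀` meets the round ball in at most a sixth
of its volume (`exists_small_facet`), and the open trihedral cones with corners on that face are
contained in it (so the fan triangles of its boundary polygon have total solid angle `≤ 4π/6`).

## References

* [KishimotoYoneda2022] N. Kishimoto, T. Yoneda, J. Math. Fluid Mech. 24 (2022) 74 =
  arXiv:2110.08039, §4 proof of Prop. 4.4 (iv) and of Prop. 4.7.
-/

noncomputable section

open Matrix Set Finset MeasureTheory

namespace Literature.Analysis.FluidPDE

namespace KY

open scoped Classical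

/-! ### Cones of a finite family of functionals -/

section Cones

variable {ι : Type*} [Fintype ι] (Φ : ι → Fin 3 → ℝ)

/-- The cone of directions where `Φ i` is positive and maximal in the family. [folklore] -/
def coneOf (i : ι) : Set (Fin 3 → ℝ) := {x | 0 < Φ i ⬝ᵥ x ∧ ∀ k, Φ k ⬝ᵥ x ≤ Φ i ⬝ᵥ x}

/-- The cones are measurable. [folklore] -/
theorem measurableSet_coneOf (i : ι) : MeasurableSet (coneOf Φ i) := by
  have h1 : MeasurableSet {x : Fin 3 → ℝ | 0 < Φ i ⬝ᵥ x} := by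
    have hc : Continuous fun x : Fin 3 → ℝ => Φ i ⬝ᵥ x := by unfold dotProduct; fun_prop
    exact (isOpen_lt continuous_const hc).measurableSet
  have h2 : MeasurableSet {x : Fin 3 → ℝ | ∀ k, Φ k ⬝ᵥ x ≤ Φ i ⬝ᵥ x} := by
    have : {x : Fin 3 → ℝ | ∀ k, Φ k ⬝ᵥ x ≤ Φ i ⬝ᵥ x} = ⋂ k, {x | Φ k ⬝ᵥ x ≤ Φ i ⬝ᵥ x} := by
      ext x; simp
    rw [this]
    refine MeasurableSet.iInter fun k => ?_
    have hc1 : Continuous fun x : Fin 3 → ℝ => Φ k ⬝ᵥ x := by unfold dotProduct; fun_prop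
    have hc2 : Continuous fun x : Fin 3 → ℝ => Φ i ⬝ᵥ x := by unfold dotProduct; fun_prop
    exact (isClosed_le hc1 hc2).measurableSet
  have : coneOf Φ i = {x : Fin 3 → ℝ | 0 < Φ i ⬝ᵥ x} ∩ {x | ∀ k, Φ k ⬝ᵥ x ≤ Φ i ⬝ᵥ x} := by
    ext x; simp [coneOf]
  rw [this]; exact h1.inter h2

omit [Fintype ι] in
/-- Two cones of the family meet inside the plane `{(Φ i - Φ j)·x = 0}`. [folklore] -/
theorem coneOf_inter_subset {i j : ι} :
    coneOf Φ i ∩ coneOf Φ j ⊆ {x : Fin 3 → ℝ | x ⬝ᵥ (Φ i - Φ j) = 0} := by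
  rintro x ⟨⟨-, hi⟩, ⟨-, hj⟩⟩
  simp only [mem_setOf_eq, dotProduct_sub, dotProduct_comm x]
  linarith [hi j, hj i]

omit [Fintype ι] in
/-- Distinct functionals give cones with null intersection. [folklore] -/
theorem volume_coneOf_inter {i j : ι} (hij : Φ i ≠ Φ j) (A B : Set (Fin 3 → ℝ)) :
    volume (coneOf Φ i ∩ A ∩ (coneOf Φ j ∩ B)) = 0 := by
  apply measure_mono_null _ (volume_plane_eq_zero (sub_ne_zero.2 hij))
  rintro x ⟨⟨hi, -⟩, ⟨hj, -⟩⟩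
  exact coneOf_inter_subset Φ ⟨hi, hj⟩

/-- **The cones of an injective family fit into the ball.** [folklore] -/
theorem sum_volume_coneOf_le (hinj : Function.Injective Φ) (R : ℝ) :
    ∑ i, volume (coneOf Φ i ∩ ball₃ R) ≤ volume (ball₃ R) := by
  have hd : Set.Pairwise (↑(Finset.univ : Finset ι))
      (Function.onFun (AEDisjoint volume) fun i => coneOf Φ i ∩ ball₃ R) := by
    intro i _ j _ hij
    exact volume_coneOf_inter Φ (fun h => hij (hinj h)) _ _
  have hm : ∀ i ∈ (Finset.univ : Finset ι), NullMeasurableSet (coneOf Φ i ∩ ball₃ R) volume :=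
    fun i _ => ((measurableSet_coneOf Φ i).inter (measurableSet_ball₃ R)).nullMeasurableSet
  rw [← measure_biUnion_finset₀ hd hm]
  exact measure_mono (by intro x hx; simp only [Set.mem_iUnion] at hx; obtain ⟨i, -, hi⟩ := hx; exact hi.2)

end Cones

/-! ### The symmetric family of three facet functionals and their negatives -/

section Six

variable (φ : Fin 3 → Fin 3 → ℝ)

/-- The six functionals `±φ_i`. [folklore] -/
def sixFamily (q : Bool × Fin 3) : Fin 3 → ℝ := if q.1 then -φ q.2 else φ q.2

/-- `sixFamily` at a negated index. [folklore] -/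
theorem sixFamily_not (b : Bool) (j : Fin 3) : sixFamily φ (!b, j) = -sixFamily φ (b, j) := by
  cases b <;> simp [sixFamily]

/-- `sixFamily` on the two sheets. [folklore] -/
theorem sixFamily_true (j : Fin 3) : sixFamily φ (true, j) = -φ j := by simp [sixFamily]

/-- `sixFamily` on the two sheets. [folklore] -/
theorem sixFamily_false (j : Fin 3) : sixFamily φ (false, j) = φ j := by simp [sixFamily]

/-- The cone of `-φ_i` is the antipode of the cone of `φ_i`. [folklore] -/
theorem coneOf_neg (i : Fin 3) :
    coneOf (sixFamily φ) (true, i) = (fun x : Fin 3 → ℝ => -x) ⁻¹' coneOf (sixFamily φ) (false, i) := by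
  ext x
  simp only [coneOf, mem_setOf_eq, Set.mem_preimage, sixFamily_true, sixFamily_false, neg_dotProduct,
    dotProduct_neg]
  constructor
  · rintro ⟨h1, h2⟩
    refine ⟨h1, fun k => ?_⟩
    rcases k with ⟨b, j⟩
    have := h2 (!b, j)
    rw [sixFamily_not, neg_dotProduct] at this
    linarith
  · rintro ⟨h1, h2⟩
    refine ⟨h1, fun k => ?_⟩
    rcases k with ⟨b, j⟩
    have := h2 (!b, j)
    rw [sixFamily_not, neg_dotProduct] at this
    linarith

/-- The antipodal cones have the same volume inside the ball. [folklore] -/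
theorem volume_coneOf_neg (i : Fin 3) (R : ℝ) :
    volume (coneOf (sixFamily φ) (true, i) ∩ ball₃ R) = volume (coneOf (sixFamily φ) (false, i) ∩ ball₃ R) := by
  have hB : (fun x : Fin 3 → ℝ => -x) ⁻¹' ball₃ R = ball₃ R := by
    ext x; simp [ball₃]
  have hset : coneOf (sixFamily φ) (true, i) ∩ ball₃ R
      = (fun x : Fin 3 → ℝ => -x) ⁻¹' (coneOf (sixFamily φ) (false, i) ∩ ball₃ R) := by
    rw [preimage_inter, hB, coneOf_neg]
  rw [hset, ← Measure.map_apply measurable_neg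
    ((measurableSet_coneOf _ _).inter (measurableSet_ball₃ R)), Measure.map_neg_eq_self]

end Six

/-! ### A face of small solid angle -/

section Small

variable {S : Finset (Fin 3 → ℝ)} {p₀ : Fin 3 → ℝ}

/-- Open trihedral cones with corners on a face lie in the cone of the face. [folklore] -/
theorem triCone_subset_coneOf {ι : Type*} [Fintype ι] {Φ : ι → Fin 3 → ℝ}
    (hle : ∀ k, ∀ s ∈ S, Φ k ⬝ᵥ s ≤ 1) {i : ι} {a b c : Fin 3 → ℝ} (ha : a ∈ S) (hb : b ∈ S)
    (hc : c ∈ S) (ha1 : Φ i ⬝ᵥ a = 1) (hb1 : Φ i ⬝ᵥ b = 1) (hc1 : Φ i ⬝ᵥ c = 1)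
    (hτ : 0 < a ⬝ᵥ (b ⨯₃ c)) : triCone a b c ⊆ coneOf Φ i := by
  intro x hx
  obtain ⟨⟨hx1, hx2⟩, hx3⟩ := hx
  simp only [halfSpace, mem_setOf_eq] at hx1 hx2 hx3
  -- barycentric coordinates of `x`
  have hid := baryc_identity (x := x) hτ.ne'
  have e2 : a ⬝ᵥ (x ⨯₃ c) = x ⬝ᵥ (c ⨯₃ a) := by
    simp [cross_apply, dotProduct, Fin.sum_univ_three]; ring
  have e3 : a ⬝ᵥ (b ⨯₃ x) = x ⬝ᵥ (a ⨯₃ b) := by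
    simp [cross_apply, dotProduct, Fin.sum_univ_three]; ring
  set α := (x ⬝ᵥ (b ⨯₃ c)) / (a ⬝ᵥ (b ⨯₃ c))
  set β := (a ⬝ᵥ (x ⨯₃ c)) / (a ⬝ᵥ (b ⨯₃ c))
  set γ := (a ⬝ᵥ (b ⨯₃ x)) / (a ⬝ᵥ (b ⨯₃ c))
  have hα : 0 < α := div_pos hx1 hτ
  have hβ : 0 < β := div_pos (by rw [e2]; exact hx2) hτ
  have hγ : 0 < γ := div_pos (by rw [e3]; exact hx3) hτ
  have hval : ∀ ψ : Fin 3 → ℝ, ψ ⬝ᵥ x = α * (ψ ⬝ᵥ a) + β * (ψ ⬝ᵥ b) + γ * (ψ ⬝ᵥ c) := by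
    intro ψ
    conv_lhs => rw [hid]
    simp only [dotProduct_add, dotProduct_smul, smul_eq_mul]
  have hi : Φ i ⬝ᵥ x = α + β + γ := by rw [hval, ha1, hb1, hc1]; ring
  refine ⟨by rw [hi]; positivity, fun k => ?_⟩
  rw [hval (Φ k), hi]
  have h1 := mul_le_mul_of_nonneg_left (hle k a ha) hα.le
  have h2 := mul_le_mul_of_nonneg_left (hle k b hb) hβ.le
  have h3 := mul_le_mul_of_nonneg_left (hle k c hc) hγ.le
  linarith

/-- **A face at `p₀` whose cone has at most a sixth of the ball's volume.** ("`Ŝ^{conv}` has at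
least six faces, hence a face with `A(F̂*) ≤ 4π/6`.") [cite: KishimotoYoneda2022, §4 proof of Prop. 4.4 (iv)] -/
theorem exists_small_facet (h0 : (0 : Fin 3 → ℝ) ∉ S) (hsymm : ∀ s ∈ S, -s ∈ S)
    (hspan : ∃ a ∈ S, ∃ b ∈ S, ∃ c ∈ S, a ⬝ᵥ (b ⨯₃ c) ≠ 0) (hp₀ : p₀ ∈ S)
    (hfar : ∀ s ∈ S, s ≠ p₀ → p₀ ⬝ᵥ s < p₀ ⬝ᵥ p₀) (R : ℝ) :
    ∃ φ : Fin 3 → ℝ, IsFacetAt S p₀ φ ∧ ∃ C : Set (Fin 3 → ℝ), MeasurableSet C ∧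
      6 * volume (C ∩ ball₃ R) ≤ volume (ball₃ R) ∧
      ∀ a ∈ S, ∀ b ∈ S, ∀ c ∈ S, φ ⬝ᵥ a = 1 → φ ⬝ᵥ b = 1 → φ ⬝ᵥ c = 1 →
        0 < a ⬝ᵥ (b ⨯₃ c) → triCone a b c ⊆ C := by
  obtain ⟨φ₁, φ₂, φ₃, hφ₁, hφ₂, hφ₃, h12, h13, h23⟩ := exists_three_facets h0 hsymm hspan hp₀ hfar
  let φ : Fin 3 → Fin 3 → ℝ := ![φ₁, φ₂, φ₃]
  have hφ : ∀ i, IsFacetAt S p₀ (φ i) := by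
    intro i; fin_cases i <;> assumption
  have hφinj : Function.Injective φ := by
    intro i j hij
    fin_cases i <;> fin_cases j <;> simp [φ] at hij ⊢ <;>
      first
        | exact h12 hij | exact h12 hij.symm | exact h13 hij | exact h13 hij.symm | exact h23 hij
        | exact h23 hij.symm
  -- the six functionals
  set Φ := sixFamily φ with hΦ
  have hΦle : ∀ k, ∀ s ∈ S, Φ k ⬝ᵥ s ≤ 1 := by
    rintro ⟨b, i⟩ s hs
    cases b
    · rw [hΦ, sixFamily_false]; exact (hφ i).1 s hs
    · rw [hΦ, sixFamily_true, neg_dotProduct]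
      have := (hφ i).1 (-s) (hsymm s hs)
      rw [dotProduct_neg] at this
      linarith
  have hΦinj : Function.Injective Φ := by
    rintro ⟨b, i⟩ ⟨b', j⟩ hij
    have hp : Φ (b, i) ⬝ᵥ p₀ = Φ (b', j) ⬝ᵥ p₀ := by rw [hij]
    cases b <;> cases b'
    · rw [hΦ, sixFamily_false, sixFamily_false] at hij
      rw [hφinj hij]
    · rw [hΦ, sixFamily_false, sixFamily_true, neg_dotProduct, (hφ i).2.1, (hφ j).2.1] at hp
      norm_num at hp
    · rw [hΦ, sixFamily_true, sixFamily_false, neg_dotProduct, (hφ i).2.1, (hφ j).2.1] at hp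
      norm_num at hp
    · rw [hΦ, sixFamily_true, sixFamily_true, neg_inj] at hij
      rw [hφinj hij]
  -- the volume count
  have hsum := sum_volume_coneOf_le Φ hΦinj R
  rw [Fintype.sum_prod_type] at hsum
  simp only [Fintype.univ_bool, Finset.sum_insert (by simp : true ∉ ({false} : Finset Bool)),
    Finset.sum_singleton] at hsum
  have hneg : ∀ i, volume (coneOf Φ (true, i) ∩ ball₃ R) = volume (coneOf Φ (false, i) ∩ ball₃ R) :=
    fun i => volume_coneOf_neg φ i R
  simp only [hneg] at hsum
  -- some `i` has `6 v_i ≤ V`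
  set v : Fin 3 → ENNReal := fun i => volume (coneOf Φ (false, i) ∩ ball₃ R) with hv
  have hsum' : 2 * (v 0 + v 1 + v 2) ≤ volume (ball₃ R) := by
    have : ∑ i : Fin 3, v i = v 0 + v 1 + v 2 := by rw [Fin.sum_univ_three]
    rw [two_mul, ← this]; exact hsum
  have hex : ∃ i : Fin 3, 6 * v i ≤ volume (ball₃ R) := by
    by_contra hno
    push Not at hno
    have h0' := hno 0
    have h1' := hno 1
    have h2' := hno 2
    have hlt : 3 * volume (ball₃ R) < 6 * (v 0 + v 1 + v 2) := by
      calc 3 * volume (ball₃ R) = volume (ball₃ R) + volume (ball₃ R) + volume (ball₃ R) := by ring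
        _ < 6 * v 0 + 6 * v 1 + 6 * v 2 := ENNReal.add_lt_add (ENNReal.add_lt_add h0' h1') h2'
        _ = 6 * (v 0 + v 1 + v 2) := by ring
    have hle : 6 * (v 0 + v 1 + v 2) ≤ 3 * volume (ball₃ R) := by
      calc 6 * (v 0 + v 1 + v 2) = 3 * (2 * (v 0 + v 1 + v 2)) := by ring
        _ ≤ 3 * volume (ball₃ R) := by gcongr
    exact absurd (lt_of_lt_of_le hlt hle) (lt_irrefl _)
  obtain ⟨i, hi⟩ := hex
  refine ⟨φ i, hφ i, coneOf Φ (false, i), measurableSet_coneOf Φ _, hi, ?_⟩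
  intro a ha b hb c hc ha1 hb1 hc1 hτ
  exact triCone_subset_coneOf (Φ := Φ) hΦle ha hb hc ha1 hb1 hc1 hτ

end Small

end KY

end Literature.Analysis.FluidPDE
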